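import Literature.Probability.Percolation.KhSThreeDisorderCrossing
import Literature.Probability.Percolation.TriSepEscape
import HarnessLib

/-!
# Khristoforov–Smirnov's Lemma 2 for a four-marked discrete domain (the printed form, via the three-disorder crossing dictionary)

Topic `Literature/Probability/Percolation`; three-disorder lineage. Khristoforov–Smirnov, arXiv:2111.15612v1, §1.2 **Lemma 2** (pp. 2–3):
«Let u₁, …, u₄ be four distinct mid-edges on ∂Ω. … P^perc_Ω[∂_{u₁u₂}Ω ↔ ∂_{u₃u₄}Ω] = P^loop_{Ω,{u₁,…,u₄}}[u₁↭u₄, u₂↭u₃]». Here for the four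
corner faces `y₀, y₁, y₂, y₃` of a Bollobás–Riordan 4-marked discrete domain `D : TriMarkedDomain 4` (`(u₁,…,u₄) = (y₀,…,y₃)`, arcs
`∂_{u₁u₂} = A₀`, `∂_{u₃u₄} = A₂`): the number of colourings of `G` with an OPEN crossing `A₀ ↔ A₂` (the tree's `IsOpenCrossing … 0 2` of
`TriDiscreteDomain.lean`) equals the number of loop configurations with disorders at the four corners in which `y₁` is linked to `y₂`
(pattern `[y₀y₃ | y₁y₂]`), and dually for the closed crossing `A₁ ↔ A₃`. Route: forget the mark `v₁` (`TriMarkedDomain.remark`), apply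
`KhSThreeDisorderCrossing` to the resulting 3-marked domain at the mid-edge `z` of the dart before the mark `v₁` (whose faces are the
corner `y₁` and a face `s'` with three `H_G`-sides), and toggle the half-edge between `z` and `y₁`
(`W_Ω(y₀,…,y₃) ≅ TXb … y₁ ⊔ TXb … s'`).

## References
* M. Khristoforov, S. Smirnov, *Percolation and O(1) loop model*, arXiv:2111.15612 (2021), §1.2 Lemma 2 (arXiv v1 pp. 2–3).
* B. Bollobás, O. Riordan, *Percolation*, CUP (2006), Ch. 7 §7.2.2 (printed p. 193: marked domains, arcs, Lemma 5).
-/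

open Finset

namespace Literature.Probability.Percolation.MarkedLoops

open Literature.Probability.Percolation Literature.Probability.LatticeModels
open Literature.Probability.Percolation.FivePoint (Inc inc_mk_iff side inc_side xiDeg XiLinked tau hexFaceVertices_eq_triple)
open Literature.Probability.Percolation.FivePoint.N5 (sideGraph side_oppFace_oppIdx xiLinked_iff_reachable l1_xiDeg_eq h1_ne_oppFace
  xorDeg_holds ht2_sideGraph_mono)
open TriMarkedDomain

/-- Auxiliary. [folklore] -/
private theorem fin3_cases_w (v j : Fin 3) : j = v ∨ j = v + 1 ∨ j = v + 2 := by revert v j; decide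

/-- Auxiliary. [folklore] -/
private theorem fin3_add_one_add_one' (j : Fin 3) : j + 1 + 1 = j + 2 := by rw [add_assoc]; rfl

section Drop

variable (D : TriMarkedDomain 4)

/-- the kept mark positions when `v₁` is forgotten: `pos 0, pos 2, pos 3`. [cite: BollobasRiordan2006, Ch. 7 §7.2.2 (p. 193)] -/
def drop1Marks : Fin 3 → ℕ := ![D.pos 0, D.pos 2, D.pos 3]

/-- the kept mark indices. [folklore] [cite: BollobasRiordan2006, Ch. 7 §7.2.2 (p. 193)] -/
def drop1Idx : Fin 3 → Fin 4 := ![0, 2, 3]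

/-- `drop1Marks j = pos (drop1Idx j)`. [folklore] [cite: BollobasRiordan2006, Ch. 7 §7.2.2 (p. 193)] -/
theorem drop1Marks_eq (j : Fin 3) : drop1Marks D j = D.pos (drop1Idx j) := by
  fin_cases j <;> rfl

/-- Auxiliary facts on the positions. [folklore] [cite: BollobasRiordan2006, Ch. 7 §7.2.2 (p. 193)] -/
theorem pos_facts₄ : D.pos 0 = 0 ∧ D.pos 0 < D.pos 1 ∧ D.pos 1 < D.pos 2 ∧ D.pos 2 < D.pos 3 ∧ D.pos 3 < #(triBdryDarts D.verts) :=
  ⟨D.pos_zero (by decide), D.pos_strictMono (by decide), D.pos_strictMono (by decide), D.pos_strictMono (by decide), D.pos_lt 3⟩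

/-- `drop1Marks` as a composition. [folklore] [cite: BollobasRiordan2006, Ch. 7 §7.2.2 (p. 193)] -/
theorem drop1Marks_eq_comp : drop1Marks D = fun j => D.pos (drop1Idx j) := funext (drop1Marks_eq D)

/-- ★ **forgetting the mark `v₁`**: the 3-marked domain with the same sites and base, marked at `v₀, v₂, v₃`.
[cite: BollobasRiordan2006, Ch. 7, proof of Lemma 12 (pp. 206–207: «follow by relabelling the domain»)] -/
def drop1 : TriMarkedDomain 3 :=
  D.remark (drop1Marks D)
    (by rw [drop1Marks_eq_comp]; exact D.pos_strictMono.comp (by decide : StrictMono drop1Idx))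
    (by
      intro j
      rw [drop1Marks_eq, drop1Marks_eq]
      show D.pos (drop1Idx j) < D.pos 0 + #(triBdryDarts D.verts)
      rw [(pos_facts₄ D).1, Nat.zero_add]
      exact D.pos_lt _)
    (fun j => by rw [drop1Marks_eq]; exact D.markable_pos _)
    (by
      intro i j hij
      simp only [drop1Marks_eq] at hij
      have := D.mark_injective hij
      exact (by decide : Function.Injective drop1Idx) this)

/-- same sites. [folklore] [cite: BollobasRiordan2006, Ch. 7 §7.2.2 (p. 193)] -/
@[simp] theorem drop1_verts : (drop1 D).verts = D.verts := rfl

/-- same boundary traversal (the base is unchanged: `pos 0 = 0`). [folklore] [cite: BollobasRiordan2006, Ch. 7 §7.2.2 (p. 193)] -/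
theorem drop1_iter (n : ℕ) : triBdryIter (drop1 D).verts (drop1 D).base n = triBdryIter D.verts D.base n := by
  unfold drop1
  rw [TriMarkedDomain.remark_iter, drop1Marks_eq]
  show triBdryIter D.verts D.base (D.pos 0 + n) = _
  rw [(pos_facts₄ D).1, Nat.zero_add]

/-- the positions. [folklore] [cite: BollobasRiordan2006, Ch. 7 §7.2.2 (p. 193)] -/
theorem drop1_pos (j : Fin 3) : (drop1 D).pos j = D.pos (drop1Idx j) := by
  unfold drop1
  rw [TriMarkedDomain.remark_pos, drop1Marks_eq, drop1Marks_eq]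
  show D.pos (drop1Idx j) - D.pos 0 = _
  rw [(pos_facts₄ D).1, Nat.sub_zero]

/-- same boundary darts by position. [folklore] [cite: BollobasRiordan2006, Ch. 7 §7.2.2 (p. 193)] -/
theorem drop1_bdart (n : ℕ) : bdart (drop1 D) n = triBdryIter D.verts D.base n := drop1_iter D n

/-- same positions of boundary darts. [folklore] [cite: BollobasRiordan2006, Ch. 7 §7.2.2 (p. 193)] -/
theorem drop1_dpos {d : Site 2 × Site 2} (hd : d ∈ triBdryDarts D.verts) : (drop1 D).dpos d = D.dpos d := by
  have h1 : D.dpos d < #(triBdryDarts (drop1 D).verts) := D.dpos_lt hd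
  have h2 : triBdryIter (drop1 D).verts (drop1 D).base (D.dpos d) = d := by rw [drop1_iter]; exact D.iter_dpos hd
  exact (drop1 D).dpos_eq_of_iter_eq h1 h2

/-- the marked darts. [folklore] [cite: BollobasRiordan2006, Ch. 7 §7.2.2 (p. 193)] -/
theorem drop1_markDart (j : Fin 3) : (drop1 D).markDart j = D.markDart (drop1Idx j) := by
  unfold markDart
  rw [drop1_iter, drop1_pos]

/-- the marked sites. [folklore] [cite: BollobasRiordan2006, Ch. 7 §7.2.2 (p. 193)] -/
theorem drop1_markSite (j : Fin 3) : (drop1 D).markSite j = D.markSite (drop1Idx j) := by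
  unfold markSite; rw [drop1_markDart]

/-- the preceding darts. [folklore] [cite: BollobasRiordan2006, Ch. 7 §7.2.2 (p. 193)] -/
theorem drop1_predDart (j : Fin 3) : predDart (drop1 D) j = predDart D (drop1Idx j) := by
  unfold predDart
  rw [drop1_iter, drop1_pos]
  rfl

/-- the corner faces: those of the kept marks. [cite: BollobasRiordan2006, Ch. 7 §7.2.2 (p. 193)] -/
theorem drop1_isCornerFace (j : Fin 3) (F : HexVertex) : IsCornerFace (drop1 D) j F ↔ IsCornerFace D (drop1Idx j) F := by
  unfold IsCornerFace
  rw [drop1_markSite, drop1_markDart, drop1_predDart]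

/-- the corner faces, as `yc`. [cite: BollobasRiordan2006, Ch. 7 §7.2.2 (p. 193)] -/
theorem drop1_yc (j : Fin 3) : yc (drop1 D) j = yc D (drop1Idx j) :=
  eq_yc D ((drop1_isCornerFace D j _).1 (yc_spec (drop1 D) j))

/-- the corner set: `{y₀, y₂, y₃}`. [cite: BollobasRiordan2006, Ch. 7 §7.2.2 (p. 193)] -/
theorem mem_corners_drop1 {F : HexVertex} : F ∈ corners (drop1 D) ↔ ∃ j : Fin 3, F = yc D (drop1Idx j) := by
  rw [mem_corners]
  simp only [drop1_yc]

/-- `y₁` is not a corner of the forgotten domain. [cite: BollobasRiordan2006, Ch. 7 §7.2.2 (p. 193)] -/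
theorem yc_one_not_mem_corners_drop1 : yc D 1 ∉ corners (drop1 D) := by
  rw [mem_corners_drop1]
  rintro ⟨j, hj⟩
  have := yc_injective D hj
  fin_cases j <;> simp [drop1Idx] at this

/-- `hBonds` is unchanged. [folklore] [cite: BollobasRiordan2006, Ch. 7 §7.2.2 (p. 193)] -/
@[simp] theorem drop1_hBonds : hBonds (drop1 D) = hBonds D := rfl

/-- the arcs: `A'₁ = A₂`, `A'₂ = A₃`. [cite: BollobasRiordan2006, Ch. 7 §7.2.2 (p. 193)] -/
theorem drop1_arc_one : (drop1 D).arc 1 = D.arc 2 := by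
  unfold drop1
  rw [remark_arc]
  unfold arc stretch
  have e : D.remarkNext (drop1Marks D) 1 = D.pos 3 := rfl
  rw [e, D.nextPos_of_lt 2 (by decide)]
  rfl

/-- the arcs: `A'₂ = A₃`. [cite: BollobasRiordan2006, Ch. 7 §7.2.2 (p. 193)] -/
theorem drop1_arc_two : (drop1 D).arc 2 = D.arc 3 := by
  unfold drop1
  rw [remark_arc]
  unfold arc stretch
  have e : D.remarkNext (drop1Marks D) 2 = D.pos 0 + #(triBdryDarts D.verts) := rfl
  rw [e, (pos_facts₄ D).1, Nat.zero_add, D.nextPos_three]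
  rfl

end Drop

section Toggle

variable (D : TriMarkedDomain 4)

/-- **the corner `y_i` is the left face of the dart preceding the `i`-th mark** (any number of marks).
[cite: BollobasRiordan2006, Ch. 7 §7.2.2 (p. 193)] -/
theorem yc_eq_leftFace_predDart {nm : ℕ} (D : TriMarkedDomain nm) (i : Fin nm) :
    yc D i = leftFace (predDart D i).1 (predDart D i).2 := by
  symm; apply eq_yc
  unfold IsCornerFace
  obtain ⟨hu, hv, hadj⟩ := mem_triBdryDarts.1 (predDart_mem D i)
  rw [hexFaceVertices_leftFace hadj, predDart_fst]
  have key := succ_predDart D i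
  unfold triBdrySucc at key
  split_ifs at key with hw
  · exfalso
    have e1 : triLeftApex (predDart D i).1 (predDart D i).2 = D.markSite i := congrArg Prod.fst key
    rw [← predDart_fst D i] at e1
    exact (triGraph_adj_triLeftApex_left hadj).ne e1.symm
  · have e2 : triLeftApex (predDart D i).1 (predDart D i).2 = (D.markDart i).2 := congrArg Prod.snd key
    rw [predDart_fst] at e2
    rw [e2, Finset.pair_comm]

/-- the face across the dart before the mark `v₁` from the corner `y₁`. [folklore] [cite: BollobasRiordan2006, Ch. 7 §7.2.2 (p. 193)] -/
noncomputable def spFace : HexVertex := leftFace (predDart D 1).2 (predDart D 1).1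

/-- ★ **the dart before `predDart 1` has the apex `v₁`**: it is `(w, o'₁)` with `w ∈ G`, `triLeftApex w o'₁ = v₁` (`mark_pred_pred`:
its tail differs from `v₁`). [cite: BollobasRiordan2006, Ch. 7 §7.2.2 (p. 193: marked at the second outside neighbour)] -/
theorem predPred_facts : ∃ w : Site 2, w ∈ D.verts ∧ triGraph.Adj w (predDart D 1).2 ∧
    triLeftApex w (predDart D 1).2 = (predDart D 1).1 := by
  obtain ⟨h00, h01, h12, h23, h3L⟩ := pos_facts₄ D
  have h2 := two_le_pos_one D
  set d'' := triBdryIter D.verts D.base (D.pos 1 - 2) with hd''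
  have hd''m : d'' ∈ triBdryDarts D.verts := triBdryIter_mem D.base_mem _
  have hsucc : triBdrySucc D.verts d'' = predDart D 1 := by
    rw [hd'', ← triBdryIter_succ]
    unfold predDart
    rw [show D.pos 1 - 2 + 1 = D.pos 1 - 1 by omega,
      show D.pos 1 + (D.bdryLen - 1) = (D.pos 1 - 1) + #(triBdryDarts D.verts) by unfold bdryLen; omega, D.isTriDisc.iter_add_card]
  have hne : d''.1 ≠ (predDart D 1).1 := by
    have := D.mark_pred_pred 1
    rw [predDart_fst]
    rw [show D.pos 1 + (#(triBdryDarts D.verts) - 2) = (D.pos 1 - 2) + #(triBdryDarts D.verts) by omega, D.isTriDisc.iter_add_card] at this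
    exact this
  obtain ⟨hu, hv, hadj⟩ := mem_triBdryDarts.1 hd''m
  unfold triBdrySucc at hsucc
  split_ifs at hsucc with hw
  · have e1 := congrArg Prod.fst hsucc
    have e2 := congrArg Prod.snd hsucc
    simp only at e1 e2
    refine ⟨d''.1, hu, ?_, ?_⟩
    · rw [← e2]; exact hadj
    · rw [← e2]; exact e1
  · have e1 := congrArg Prod.fst hsucc
    simp only at e1
    exact absurd e1 hne

/-- ★ **the face `s'` has three `H_G`-sides** (its vertices are `o'₁`, `v₁` and the tail `w ∈ G` of the dart before `predDart 1`).
[cite: BollobasRiordan2006, Ch. 7 §7.2.2 (p. 193)] -/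
theorem allSides_spFace : AllSides (drop1 D) (spFace D) := by
  obtain ⟨w, hw, hadj, hapex⟩ := predPred_facts D
  obtain ⟨hu, hv, hadj'⟩ := mem_triBdryDarts.1 (predDart_mem D 1)
  set F := leftFace w (predDart D 1).2 with hFdef
  obtain ⟨j, hj, hj1⟩ := exists_eq_faceVertex_of_adj hadj
  rw [← hFdef] at hj hj1
  have h2 : (predDart D 1).1 = faceVertex F (j + 2) := by
    rw [← triLeftApex_faceVertex, ← hj, ← hj1, hapex]
  -- spFace = F (the next anticlockwise dart of F is o'₁ → v₁)
  have hF : spFace D = F := by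
    have := leftFace_faceVertex F (j + 1)
    rw [fin3_add_one_add_one', ← hj1, ← h2] at this
    exact this
  intro i
  rw [drop1_hBonds, hF]
  -- every side has an endpoint in G: the vertices x_j = w ∈ G and x_{j+2} = v₁ ∈ G
  have hadjs := TriMarkedDomain.adj_faceVertex_succ F (i + 1)
  rw [fin3_add_one_add_one'] at hadjs
  show s(faceVertex F (i + 1), faceVertex F (i + 2)) ∈ hBonds D
  refine mem_hBonds D hadjs ?_
  rcases fin3_cases_w j i with e | e | e
  · -- i = j: x_{i+2} = v₁
    exact Or.inr (by rw [e, ← h2]; exact hu)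
  · -- i = j + 1: x_{i+1} = x_{j+2} = v₁
    exact Or.inl (by rw [e, fin3_add_one_add_one', ← h2]; exact hu)
  · -- i = j + 2: x_{i+1} = x_j = w
    exact Or.inl (by rw [e, fin3_add_two_add_one, ← hj]; exact hw)

end Toggle

section FourLoops

variable (D : TriMarkedDomain 4)

open Classical in
/-- **`W_Ω(y₀,y₁,y₂,y₃)`**: loop configurations (edge sets of `H_G`) whose odd faces are exactly the four corner faces.
[cite: KhristoforovSmirnov2021, §1.2 (arXiv v1 p. 2: loop configurations with disorders at marked points)] -/
noncomputable def fourLoops : Finset (Finset (Sym2 (Site 2))) :=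
  (hBonds D).powerset.filter fun ξ => ParityIs D ξ (corners D)

/-- membership in `fourLoops`. [cite: KhristoforovSmirnov2021, §1.2 (arXiv v1 p. 2)] -/
theorem mem_fourLoops {ξ : Finset (Sym2 (Site 2))} : ξ ∈ fourLoops D ↔ ξ ⊆ hBonds D ∧ ParityIs D ξ (corners D) := by
  classical
  unfold fourLoops; rw [Finset.mem_filter, Finset.mem_powerset]

/-- the corner set has four elements. [folklore] [cite: BollobasRiordan2006, Ch. 7 §7.2.2 (p. 193)] -/
theorem card_corners₄ : #(corners D) = 4 := by
  unfold corners
  rw [Finset.card_image_of_injective _ (yc_injective D), Finset.card_univ, Fintype.card_fin]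

/-- ★ **`#W_Ω(y₀,…,y₃) = 2 ^ #G`.** [cite: KhristoforovSmirnov2021, §1.2 (arXiv v1 p. 2: «exactly 2^{#Faces(Ω)} loop configurations with given disorders»)] -/
theorem card_fourLoops : #(fourLoops D) = 2 ^ #D.verts := by
  classical
  have h := card_filter_parity_eq D (O := corners D) (fun F hF => by
    obtain ⟨i, rfl⟩ := (mem_corners D).1 hF; exact yc_mem_touching D i) (by rw [card_corners₄]; exact ⟨2, rfl⟩)
  unfold fourLoops ParityIs
  rw [← h]
  congr 1
  ext ξ
  simp only [Finset.mem_filter]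

/-- the bond `b` of the dart before the mark `v₁` (between `y₁` and `s'`). [folklore] [cite: BollobasRiordan2006, Ch. 7 §7.2.2 (p. 193)] -/
noncomputable def bPred : Sym2 (Site 2) := s((predDart D 1).1, (predDart D 1).2)

open Classical in
/-- **the half-edge toggle**: drop the bond `b` if present. [cite: KhristoforovSmirnov2021, §1.2 (arXiv v1 p. 2: half-edges at a disorder)] -/
noncomputable def toggle (ξ : Finset (Sym2 (Site 2))) : Finset (Sym2 (Site 2)) := if bPred D ∈ ξ then ξ.erase (bPred D) else ξ

variable {D}

/-- `b ∈ hBonds`. [folklore] [cite: BollobasRiordan2006, Ch. 7 §7.2.2 (p. 193)] -/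
theorem bPred_mem_hBonds : bPred D ∈ hBonds D := by
  obtain ⟨hu, hv, hadj⟩ := mem_triBdryDarts.1 (predDart_mem D 1)
  exact mem_hBonds D hadj (Or.inl hu)

/-- the side index of `b` in the face `s'`. [folklore] [cite: BollobasRiordan2006, Ch. 7 §7.2.2 (p. 193)] -/
theorem exists_side_spFace_eq : ∃ i : Fin 3, side (spFace D) i = bPred D := by
  obtain ⟨hu, hv, hadj⟩ := mem_triBdryDarts.1 (predDart_mem D 1)
  obtain ⟨j, hj, hj1⟩ := exists_eq_faceVertex_of_adj hadj.symm
  refine ⟨j + 2, ?_⟩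
  unfold side bPred spFace
  rw [fin3_add_two_add_one, fin3_add_two_add_two, ← hj, ← hj1, Sym2.eq_swap]

/-- `y₁` and `s'` are the two faces of `b`: `s' ≠ y₁` and `y₁ = oppFace s' i`. [folklore] [cite: BollobasRiordan2006, Ch. 7 §7.2.2 (p. 193)] -/
theorem yc_one_eq_oppFace {i : Fin 3} (hi : side (spFace D) i = bPred D) : yc D 1 = oppFace (spFace D) i ∧ yc D 1 ≠ spFace D := by
  obtain ⟨hu, hv, hadj⟩ := mem_triBdryDarts.1 (predDart_mem D 1)
  have hy : yc D 1 = leftFace (predDart D 1).1 (predDart D 1).2 := yc_eq_leftFace_predDart D 1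
  have hne : yc D 1 ≠ spFace D := by
    rw [hy]; unfold spFace; exact leftFace_ne_leftFace_symm hadj
  refine ⟨?_, hne⟩
  have hb : side (spFace D) i ∈ hBonds D := by rw [hi]; exact bPred_mem_hBonds
  have hsT : spFace D ∈ triFacesTouching D.verts := mem_touching_of_side_mem D hb
  have hoT : oppFace (spFace D) i ∈ triFacesTouching D.verts :=
    mem_touching_of_side_mem D (j := oppIdx (spFace D) i) (by rw [side_oppFace_oppIdx]; exact hb)
  have hyT : yc D 1 ∈ triFacesTouching D.verts := yc_mem_touching D 1
  have iy : Inc (yc D 1) (side (spFace D) i) := by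
    rw [hi]; unfold bPred; rw [inc_mk_iff, hy, hexFaceVertices_leftFace hadj]; simp
  have io : Inc (oppFace (spFace D) i) (side (spFace D) i) := by rw [← side_oppFace_oppIdx]; exact inc_side _ _
  rcases eq_or_eq_of_inc_three D hb hsT hoT hyT (inc_side _ _) io iy (h1_ne_oppFace _ i) with h | h
  · exact absurd h hne
  · exact h

/-- `s'` is not a corner face (it has two vertices in `G`). [folklore] [cite: BollobasRiordan2006, Ch. 7 §7.2.2 (p. 193)] -/
theorem spFace_not_mem_corners : spFace D ∉ corners D := by
  obtain ⟨w, hw, hadj, hapex⟩ := predPred_facts D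
  obtain ⟨hu, hv, hadj'⟩ := mem_triBdryDarts.1 (predDart_mem D 1)
  -- w and v₁ are two distinct G-vertices of s'
  have hverts : hexFaceVertices (spFace D) = {(predDart D 1).2, (predDart D 1).1, triLeftApex (predDart D 1).2 (predDart D 1).1} := by
    unfold spFace; exact hexFaceVertices_leftFace hadj'.symm
  -- the apex of (o'₁, v₁) is w: the face is leftFace w o'₁
  have hwmem : w ∈ hexFaceVertices (spFace D) := by
    obtain ⟨j, hj, hj1⟩ := exists_eq_faceVertex_of_adj hadj
    have h2 : (predDart D 1).1 = faceVertex (leftFace w (predDart D 1).2) (j + 2) := by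
      rw [← triLeftApex_faceVertex, ← hj, ← hj1, hapex]
    have hF : spFace D = leftFace w (predDart D 1).2 := by
      have := leftFace_faceVertex (leftFace w (predDart D 1).2) (j + 1)
      rw [fin3_add_one_add_one', ← hj1, ← h2] at this
      exact this
    rw [hF, hexFaceVertices_leftFace hadj]; simp
  have hvmem : (predDart D 1).1 ∈ hexFaceVertices (spFace D) := by rw [hverts]; simp
  have hne : w ≠ (predDart D 1).1 := fun e => (triGraph_adj_triLeftApex_left hadj).ne (e.trans hapex.symm)
  rw [not_mem_corners_iff]
  intro i
  exact not_corner_of_two_mem D hwmem hvmem hw hu hne i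

/-- a configuration of `W₄` has at most two sides at every face. [cite: KhristoforovSmirnov2021, §1.2 (arXiv v1 pp. 2–3)] -/
theorem xiDeg_le_two_of_mem_fourLoops {ξ : Finset (Sym2 (Site 2))} (hξ : ξ ∈ fourLoops D) (F : HexVertex) : xiDeg ξ F ≤ 2 := by
  classical
  obtain ⟨hsub, hpar⟩ := (mem_fourLoops D).1 hξ
  by_contra hlt
  rw [not_le, l1_xiDeg_eq] at hlt
  have hall : ∀ j : Fin 3, side F j ∈ ξ := by
    have heq : ((Finset.univ : Finset (Fin 3)).filter fun j => side F j ∈ ξ) = Finset.univ :=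
      Finset.eq_univ_of_card _ (by
        rw [Fintype.card_fin]
        have := (Finset.card_filter_le _ _ : #((Finset.univ : Finset (Fin 3)).filter fun j => side F j ∈ ξ) ≤ _)
        rw [Finset.card_univ, Fintype.card_fin] at this; omega)
    intro j; have := Finset.mem_univ j; rw [← heq, Finset.mem_filter] at this; exact this.2
  have hFt : F ∈ triFacesTouching D.verts := mem_touching_of_side_mem D (hsub (hall 0))
  have hodd : Odd (xiDeg ξ F) := by
    rw [l1_xiDeg_eq, Finset.filter_true_of_mem fun j _ => hall j, Finset.card_univ, Fintype.card_fin]; decide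
  obtain ⟨i, rfl⟩ := (mem_corners D).1 ((hpar F hFt).1 hodd)
  have h2 := xiDeg_corner_le_two D hsub (yc_spec D i)
  rw [l1_xiDeg_eq, Finset.filter_true_of_mem fun j _ => hall j, Finset.card_univ, Fintype.card_fin] at h2
  omega

/-! ### the toggle lands in the XOR space at `z = predDart 1` of the forgotten domain -/

/-- corners of the forgotten domain: the corners of `D` other than `y₁`. [cite: BollobasRiordan2006, Ch. 7 §7.2.2 (p. 193)] -/
theorem mem_corners_drop1_iff {F : HexVertex} : F ∈ corners (drop1 D) ↔ F ∈ corners D ∧ F ≠ yc D 1 := by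
  rw [mem_corners_drop1, mem_corners]
  constructor
  · rintro ⟨j, rfl⟩
    refine ⟨⟨drop1Idx j, rfl⟩, fun e => ?_⟩
    have := yc_injective D e
    fin_cases j <;> simp [drop1Idx] at this
  · rintro ⟨⟨i, rfl⟩, hne⟩
    have : i = 0 ∨ i = 1 ∨ i = 2 ∨ i = 3 := by fin_cases i <;> simp
    rcases this with rfl | rfl | rfl | rfl
    · exact ⟨0, rfl⟩
    · exact absurd rfl hne
    · exact ⟨1, rfl⟩
    · exact ⟨2, rfl⟩

/-- ★ **toggle, half `y₁`**: a configuration of `W₄` not containing `b` lies in `TXb (drop1 D) s' i y₁`.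
[cite: KhristoforovSmirnov2021, §1.2 (arXiv v1 pp. 2–3)] -/
theorem toggle_mem_TXb_of_not_mem {i : Fin 3} (hi : side (spFace D) i = bPred D) {ξ : Finset (Sym2 (Site 2))} (hξ : ξ ∈ fourLoops D)
    (hb : bPred D ∉ ξ) : ξ ∈ TXb (drop1 D) (spFace D) i (yc D 1) := by
  obtain ⟨hsub, hpar⟩ := (mem_fourLoops D).1 hξ
  rw [mem_TXb_iff]
  constructor
  · intro e he
    rw [Finset.mem_erase, hi, drop1_hBonds]
    exact ⟨fun h => hb (h ▸ he), hsub he⟩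
  · intro F hF
    rw [drop1_verts] at hF
    rw [hpar F hF, Finset.mem_symmDiff, Finset.mem_singleton, mem_corners_drop1_iff]
    have hy1 : yc D 1 ∈ corners D := yc_mem_corners D 1
    constructor
    · intro hc
      by_cases h : F = yc D 1
      · exact Or.inr ⟨h, fun h' => h'.2 h⟩
      · exact Or.inl ⟨⟨hc, h⟩, h⟩
    · rintro (⟨⟨hc, -⟩, -⟩ | ⟨rfl, -⟩)
      · exact hc
      · exact hy1

/-- Auxiliary: `ξ.erase b = ξ Δ {b}` when `b ∈ ξ`. [folklore] -/
private theorem erase_eq_symmDiff₄ {b : Sym2 (Site 2)} {ξ : Finset (Sym2 (Site 2))} (h : b ∈ ξ) : ξ.erase b = symmDiff ξ {b} := by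
  ext e
  rw [Finset.mem_erase, Finset.mem_symmDiff, Finset.mem_singleton]
  constructor
  · rintro ⟨hne, he⟩; exact Or.inl ⟨he, hne⟩
  · rintro (⟨he, hne⟩ | ⟨rfl, hn⟩)
    · exact ⟨hne, he⟩
    · exact absurd h hn

/-- ★ **toggle, half `s'`**: a configuration of `W₄` containing `b`, with `b` erased, lies in `TXb (drop1 D) s' i s'`.
[cite: KhristoforovSmirnov2021, §1.2 (arXiv v1 pp. 2–3)] -/
theorem toggle_mem_TXb_of_mem {i : Fin 3} (hi : side (spFace D) i = bPred D) {ξ : Finset (Sym2 (Site 2))} (hξ : ξ ∈ fourLoops D)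
    (hb : bPred D ∈ ξ) : ξ.erase (bPred D) ∈ TXb (drop1 D) (spFace D) i (spFace D) := by
  obtain ⟨hsub, hpar⟩ := (mem_fourLoops D).1 hξ
  obtain ⟨hy, hne⟩ := yc_one_eq_oppFace hi
  have hbh : side (spFace D) i ∈ hBonds D := by rw [hi]; exact bPred_mem_hBonds
  rw [mem_TXb_iff]
  constructor
  · intro e he
    rw [Finset.mem_erase] at he
    rw [Finset.mem_erase, hi, drop1_hBonds]
    exact ⟨he.1, hsub he.2⟩
  · intro F hF
    rw [drop1_verts] at hF
    rw [erase_eq_symmDiff₄ hb, xorDeg_holds, hpar F hF, ← hi, odd_xiDeg_side_iff D hbh hF, ← hy, Finset.mem_symmDiff,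
      Finset.mem_singleton, mem_corners_drop1_iff]
    have hsc : spFace D ∉ corners D := spFace_not_mem_corners
    have hy1 : yc D 1 ∈ corners D := yc_mem_corners D 1
    by_cases h1 : F = spFace D
    · subst h1; simp [hsc]
    · by_cases h2 : F = yc D 1
      · subst h2; simp [hy1, hne]
      · simp [h1, h2]

/-- ★ **the toggle is injective on `W₄`.** [cite: KhristoforovSmirnov2021, §1.2 (arXiv v1 pp. 2–3)] -/
theorem toggle_injOn {i : Fin 3} (hi : side (spFace D) i = bPred D) : Set.InjOn (toggle D) ↑(fourLoops D) := by
  classical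
  intro ξ₁ h₁ ξ₂ h₂ h
  have h₁' := Finset.mem_coe.1 h₁
  have h₂' := Finset.mem_coe.1 h₂
  obtain ⟨-, hne⟩ := yc_one_eq_oppFace hi
  have hsT : spFace D ∈ triFacesTouching (drop1 D).verts := by
    rw [drop1_verts]; exact mem_touching_of_side_mem D (by rw [hi]; exact bPred_mem_hBonds)
  unfold toggle at h
  by_cases hb1 : bPred D ∈ ξ₁ <;> by_cases hb2 : bPred D ∈ ξ₂
  · rw [if_pos hb1, if_pos hb2] at h
    rw [← Finset.insert_erase hb1, ← Finset.insert_erase hb2, h]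
  · rw [if_pos hb1, if_neg hb2] at h
    exfalso
    have m1 := toggle_mem_TXb_of_mem hi h₁' hb1
    have m2 := toggle_mem_TXb_of_not_mem hi h₂' hb2
    rw [h] at m1
    exact not_mem_TXb_of_mem_TXb hsT hne.symm m1 m2
  · rw [if_neg hb1, if_pos hb2] at h
    exfalso
    have m1 := toggle_mem_TXb_of_not_mem hi h₁' hb1
    have m2 := toggle_mem_TXb_of_mem hi h₂' hb2
    rw [← h] at m2
    exact not_mem_TXb_of_mem_TXb hsT hne.symm m2 m1
  · rw [if_neg hb1, if_neg hb2] at h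
    exact h

/-- ★ **the toggle is a bijection `W₄ → TXb … s' ⊔ TXb … y₁`** (injective, into, equal cardinalities `2 ^ #G`).
[cite: KhristoforovSmirnov2021, §1.2 (arXiv v1 pp. 2–3)] -/
theorem toggle_image_eq {i : Fin 3} (hi : side (spFace D) i = bPred D) :
    (fourLoops D).image (toggle D) = TXb (drop1 D) (spFace D) i (spFace D) ∪ TXb (drop1 D) (spFace D) i (yc D 1) := by
  classical
  obtain ⟨hy, -⟩ := yc_one_eq_oppFace hi
  apply Finset.eq_of_subset_of_card_le
  · intro η hη
    obtain ⟨ξ, hξ, rfl⟩ := Finset.mem_image.1 hη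
    rw [Finset.mem_union]
    unfold toggle
    by_cases hb : bPred D ∈ ξ
    · rw [if_pos hb]; exact Or.inl (toggle_mem_TXb_of_mem hi hξ hb)
    · rw [if_neg hb]; exact Or.inr (toggle_mem_TXb_of_not_mem hi hξ hb)
  · rw [Finset.card_image_of_injOn (toggle_injOn hi), card_fourLoops]
    calc #(TXb (drop1 D) (spFace D) i (spFace D) ∪ TXb (drop1 D) (spFace D) i (yc D 1))
        ≤ #(TXb (drop1 D) (spFace D) i (spFace D)) + #(TXb (drop1 D) (spFace D) i (yc D 1)) := Finset.card_union_le _ _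
      _ = 2 ^ #D.verts := by rw [hy]; exact card_TXb_add_card_TXb (drop1 D) (by decide) (allSides_spFace D) i

end FourLoops

section Final

variable (D : TriMarkedDomain 4)

/-- the position of `predDart 1` is `pos 1 − 1`. [folklore] [cite: BollobasRiordan2006, Ch. 7 §7.2.2 (p. 193)] -/
theorem dpos_predDart_one : D.dpos (predDart D 1) = D.pos 1 - 1 := by
  obtain ⟨h00, h01, h12, h23, h3L⟩ := pos_facts₄ D
  have h := dpos_predDart_succ D 1
  have hlt := D.dpos_lt (predDart_mem D 1)
  by_cases hc : D.dpos (predDart D 1) + 1 < #(triBdryDarts D.verts)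
  · rw [Nat.mod_eq_of_lt hc] at h; omega
  · rw [show D.dpos (predDart D 1) + 1 = #(triBdryDarts D.verts) by omega, Nat.mod_self] at h; omega

/-- `z = predDart 1` lies on the stretch `A₀` of the forgotten domain. [cite: BollobasRiordan2006, Ch. 7 §7.2.2 (p. 193)] -/
theorem drop1_stretchIdx_predDart_one : (drop1 D).stretchIdx₃ ((drop1 D).dpos (predDart D 1)) = 0 := by
  obtain ⟨h00, h01, h12, h23, h3L⟩ := pos_facts₄ D
  rw [drop1_dpos D (predDart_mem D 1), dpos_predDart_one]
  apply stretchIdx_zero_of_lt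
  rw [drop1_verts, Nat.mod_eq_of_lt (by omega), drop1_pos]
  show D.pos 1 - 1 < D.pos 2
  omega

/-- ★ **the sub-arc `∂_{y₀ z}` of the forgotten domain is the arc `A₀` of `D`** (tails of the darts from `v₀` to `predDart 1`, whose tail is `v₁`).
[cite: BollobasRiordan2006, Ch. 7 §7.2.2 (p. 193: «We include both vᵢ and v_{i+1} into Aᵢ»)] -/
theorem arcTo_drop1 : arcTo (drop1 D) (predDart D 1).1 (predDart D 1).2 = D.arc 0 := by
  obtain ⟨h00, h01, h12, h23, h3L⟩ := pos_facts₄ D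
  have hbd : bdart (drop1 D) = triBdryIter D.verts D.base := funext (drop1_bdart D)
  unfold arcTo arc stretch
  rw [show ((predDart D 1).1, (predDart D 1).2) = predDart D 1 from rfl, drop1_dpos D (predDart_mem D 1), dpos_predDart_one,
    show D.pos 1 - 1 + 1 = D.pos 1 by omega, Finset.range_eq_Ico, hbd, h00, D.nextPos_of_lt 0 (by decide)]
  rfl

/-- ★ **the sub-arc `∂_{z y₁}` of the forgotten domain is the arc `A₁` of `D`.** [cite: BollobasRiordan2006, Ch. 7 §7.2.2 (p. 193)] -/
theorem arcFrom_drop1 : arcFrom (drop1 D) (predDart D 1).1 (predDart D 1).2 = D.arc 1 := by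
  obtain ⟨h00, h01, h12, h23, h3L⟩ := pos_facts₄ D
  have h2 := two_le_pos_one D
  unfold arcFrom arc stretch
  rw [show ((predDart D 1).1, (predDart D 1).2) = predDart D 1 from rfl, drop1_dpos D (predDart_mem D 1), dpos_predDart_one, drop1_pos,
    D.nextPos_of_lt 1 (by decide)]
  show ((Finset.Ico (D.pos 1 - 1) (D.pos 2)).image (bdart (drop1 D))).image Prod.fst =
    ((Finset.Ico (D.pos 1) (D.pos 2)).image (triBdryIter D.verts D.base)).image Prod.fst
  have hv1 : (triBdryIter D.verts D.base (D.pos 1 - 1)).1 = (triBdryIter D.verts D.base (D.pos 1)).1 := by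
    have := predDart_fst D 1
    unfold predDart markSite markDart at this
    rwa [show D.pos 1 + (D.bdryLen - 1) = (D.pos 1 - 1) + #(triBdryDarts D.verts) by unfold bdryLen; omega,
      D.isTriDisc.iter_add_card] at this
  ext x
  simp only [Finset.mem_image, Finset.mem_Ico, drop1_bdart]
  constructor
  · rintro ⟨d, ⟨n, ⟨hn1, hn2⟩, rfl⟩, rfl⟩
    by_cases hn : n = D.pos 1 - 1
    · exact ⟨triBdryIter D.verts D.base (D.pos 1), ⟨D.pos 1, ⟨le_rfl, h12⟩, rfl⟩, by rw [hn, hv1]⟩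
    · exact ⟨triBdryIter D.verts D.base n, ⟨n, ⟨by omega, hn2⟩, rfl⟩, rfl⟩
  · rintro ⟨d, ⟨n, ⟨hn1, hn2⟩, rfl⟩, rfl⟩
    exact ⟨triBdryIter D.verts D.base n, ⟨n, ⟨by omega, hn2⟩, rfl⟩, rfl⟩

/-- the blue crossing of the forgotten domain at `z` is the open crossing `A₀ ↔ A₂`. [cite: BollobasRiordan2006, Ch. 7 Lemma 5 (p. 193)] -/
theorem blueCross_drop1_iff (T : Finset (Site 2)) :
    BlueCross (drop1 D) (predDart D 1).1 (predDart D 1).2 T ↔ D.IsOpenCrossing (↑T : Set (Site 2)) 0 2 := by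
  unfold BlueCross TriMarkedDomain.IsOpenCrossing
  rw [arcTo_drop1, drop1_arc_one, drop1_verts]

/-- the yellow crossing of the forgotten domain at `z` is the closed crossing `A₁ ↔ A₃`. [cite: BollobasRiordan2006, Ch. 7 Lemma 5 (p. 193)] -/
theorem yellowCross_drop1_iff (T : Finset (Site 2)) :
    YellowCross (drop1 D) (predDart D 1).1 (predDart D 1).2 T ↔ D.IsClosedCrossing (↑T : Set (Site 2)) 1 3 := by
  unfold YellowCross TriMarkedDomain.IsClosedCrossing
  rw [arcFrom_drop1, drop1_arc_two, drop1_verts]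

variable {D}

/-- ★ **the link pattern is preserved by the toggle**: `y₁` is linked to the corner `c ≠ y₁` in `ξ ∈ W₄` iff the odd endpoint of
`toggle ξ` is linked to `c` there. [cite: KhristoforovSmirnov2021, §1.2 (arXiv v1 pp. 2–3: link patterns)] -/
theorem reach_toggle_iff {i : Fin 3} (hi : side (spFace D) i = bPred D) {ξ : Finset (Sym2 (Site 2))} (hξ : ξ ∈ fourLoops D)
    {c : HexVertex} (hc : c ∈ corners D) (hcy : c ≠ yc D 1) :
    (sideGraph ξ).Reachable (yc D 1) c ↔
      (sideGraph (toggle D ξ)).Reachable (if bPred D ∈ ξ then spFace D else yc D 1) c := by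
  classical
  obtain ⟨hsub, hpar⟩ := (mem_fourLoops D).1 hξ
  obtain ⟨hy, hne⟩ := yc_one_eq_oppFace hi
  unfold toggle
  by_cases hb : bPred D ∈ ξ
  · rw [if_pos hb, if_pos hb]
    -- y₁ ~ s' in ξ across b
    have hadj : (sideGraph ξ).Adj (yc D 1) (spFace D) := by
      refine ⟨oppIdx (spFace D) i, ?_, ?_⟩
      · rw [hy, oppFace_oppFace]
      · rw [hy, side_oppFace_oppIdx, hi]; exact hb
    have back : ∀ c', (sideGraph (ξ.erase (bPred D))).Reachable (spFace D) c' → (sideGraph ξ).Reachable (yc D 1) c' := fun c' h =>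
      hadj.reachable.trans (h.mono (ht2_sideGraph_mono (Finset.erase_subset _ _)))
    refine ⟨fun hR => ?_, back c⟩
    -- the corner reached by s' in ξ ∖ b
    have hξ' := toggle_mem_TXb_of_mem hi hξ hb
    obtain ⟨j, hj, -⟩ := existsUnique_inClassX (drop1 D) (allSides_spFace D) i (s := spFace D) (by simp) hξ'
    rw [hbK_inClassX_iff] at hj
    obtain ⟨-, hR'⟩ := hj
    have hR'' := back _ hR'
    -- both c and yc (drop1 D) j are odd corners ≠ y₁ reached from y₁: equal
    have hdeg := xiDeg_le_two_of_mem_fourLoops hξ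
    have hy1T : yc D 1 ∈ triFacesTouching D.verts := yc_mem_touching D 1
    have hy1odd : Odd (xiDeg ξ (yc D 1)) := (hpar _ hy1T).2 (yc_mem_corners D 1)
    obtain ⟨-, huniq⟩ := odd_component D hsub hdeg hy1T hy1odd
    have hcj : yc (drop1 D) j ∈ corners D ∧ yc (drop1 D) j ≠ yc D 1 := mem_corners_drop1_iff.1 (yc_mem_corners _ j)
    have hco : Odd (xiDeg ξ c) := (hpar _ (by obtain ⟨i', rfl⟩ := (mem_corners D).1 hc; exact yc_mem_touching D i')).2 hc
    have hjo : Odd (xiDeg ξ (yc (drop1 D) j)) :=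
      (hpar _ (by obtain ⟨i', hi'⟩ := (mem_corners D).1 hcj.1; rw [hi']; exact yc_mem_touching D i')).2 hcj.1
    have := huniq c (yc (drop1 D) j) hR hR'' hco hjo hcy hcj.2
    rw [this]; exact hR'
  · rw [if_neg hb, if_neg hb]

open Classical in
/-- counting, half `s'`: configurations containing `b`, by `ξ ↦ ξ.erase b`. [cite: KhristoforovSmirnov2021, §1.2 (arXiv v1 pp. 2–3)] -/
theorem card_filter_mem_eq {i : Fin 3} (hi : side (spFace D) i = bPred D) (j : Fin 3) :
    #((fourLoops D).filter fun ξ => bPred D ∈ ξ ∧ (sideGraph ξ).Reachable (yc D 1) (yc (drop1 D) j)) =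
      #((TXb (drop1 D) (spFace D) i (spFace D)).filter fun η =>
        InClassX (drop1 D) (faceVertex (spFace D) (i + 1)) (faceVertex (spFace D) (i + 2)) (spFace D) j η) := by
  obtain ⟨hy, hne⟩ := yc_one_eq_oppFace hi
  have hcj : yc (drop1 D) j ∈ corners D ∧ yc (drop1 D) j ≠ yc D 1 := mem_corners_drop1_iff.1 (yc_mem_corners _ j)
  have hsT : spFace D ∈ triFacesTouching (drop1 D).verts := by
    rw [drop1_verts]; exact mem_touching_of_side_mem D (by rw [hi]; exact bPred_mem_hBonds)
  apply Finset.card_bij (fun ξ _ => ξ.erase (bPred D))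
  · intro ξ hξ
    rw [Finset.mem_filter] at hξ ⊢
    obtain ⟨hξ, hb, hR⟩ := hξ
    refine ⟨toggle_mem_TXb_of_mem hi hξ hb, ?_⟩
    rw [hbK_inClassX_iff]
    refine ⟨toggle_mem_TXb_of_mem hi hξ hb, ?_⟩
    have := (reach_toggle_iff hi hξ hcj.1 hcj.2).1 hR
    unfold toggle at this; rwa [if_pos hb, if_pos hb] at this
  · intro ξ₁ h₁ ξ₂ h₂ h
    have hb1 := (Finset.mem_filter.1 h₁).2.1
    have hb2 := (Finset.mem_filter.1 h₂).2.1
    rw [← Finset.insert_erase hb1, ← Finset.insert_erase hb2, h]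
  · intro η hη
    rw [Finset.mem_filter] at hη
    obtain ⟨hη, hcl⟩ := hη
    -- η comes from some ξ ∈ W₄ (bijection onto the union); it must contain b
    have hmem : η ∈ (fourLoops D).image (toggle D) := by rw [toggle_image_eq hi, Finset.mem_union]; exact Or.inl hη
    obtain ⟨ξ, hξ, hξη⟩ := Finset.mem_image.1 hmem
    have hb : bPred D ∈ ξ := by
      by_contra hb
      unfold toggle at hξη; rw [if_neg hb] at hξη; subst hξη
      exact not_mem_TXb_of_mem_TXb hsT hne.symm hη (toggle_mem_TXb_of_not_mem hi hξ hb)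
    have hξη' : ξ.erase (bPred D) = η := by unfold toggle at hξη; rwa [if_pos hb] at hξη
    refine ⟨ξ, ?_, hξη'⟩
    rw [Finset.mem_filter]
    refine ⟨hξ, hb, ?_⟩
    rw [hbK_inClassX_iff] at hcl
    have := reach_toggle_iff hi hξ hcj.1 hcj.2
    unfold toggle at this; rw [if_pos hb, if_pos hb, hξη'] at this
    exact this.2 hcl.2

open Classical in
/-- counting, half `y₁`: configurations avoiding `b`, by the identity. [cite: KhristoforovSmirnov2021, §1.2 (arXiv v1 pp. 2–3)] -/
theorem card_filter_not_mem_eq {i : Fin 3} (hi : side (spFace D) i = bPred D) (j : Fin 3) :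
    #((fourLoops D).filter fun ξ => bPred D ∉ ξ ∧ (sideGraph ξ).Reachable (yc D 1) (yc (drop1 D) j)) =
      #((TXb (drop1 D) (spFace D) i (yc D 1)).filter fun η =>
        InClassX (drop1 D) (faceVertex (spFace D) (i + 1)) (faceVertex (spFace D) (i + 2)) (yc D 1) j η) := by
  obtain ⟨hy, hne⟩ := yc_one_eq_oppFace hi
  have hsT : spFace D ∈ triFacesTouching (drop1 D).verts := by
    rw [drop1_verts]; exact mem_touching_of_side_mem D (by rw [hi]; exact bPred_mem_hBonds)
  apply Finset.card_bij (fun ξ _ => ξ)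
  · intro ξ hξ
    rw [Finset.mem_filter] at hξ ⊢
    obtain ⟨hξ, hb, hR⟩ := hξ
    refine ⟨toggle_mem_TXb_of_not_mem hi hξ hb, ?_⟩
    rw [hbK_inClassX_iff]
    exact ⟨toggle_mem_TXb_of_not_mem hi hξ hb, hR⟩
  · intro ξ₁ _ ξ₂ _ h; exact h
  · intro η hη
    rw [Finset.mem_filter] at hη
    obtain ⟨hη, hcl⟩ := hη
    have hmem : η ∈ (fourLoops D).image (toggle D) := by rw [toggle_image_eq hi, Finset.mem_union]; exact Or.inr hη
    obtain ⟨ξ, hξ, hξη⟩ := Finset.mem_image.1 hmem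
    have hb : bPred D ∉ ξ := by
      intro hb
      unfold toggle at hξη; rw [if_pos hb] at hξη; subst hξη
      exact not_mem_TXb_of_mem_TXb hsT hne.symm (toggle_mem_TXb_of_mem hi hξ hb) hη
    have hξη' : ξ = η := by unfold toggle at hξη; rwa [if_neg hb] at hξη
    subst hξη'
    refine ⟨ξ, ?_, rfl⟩
    rw [Finset.mem_filter]
    rw [hbK_inClassX_iff] at hcl
    exact ⟨hξ, hb, hcl.2⟩

open Classical in
/-- ★ **counting through the toggle**: configurations of `W₄` with `y₁` linked to the corner `yc (drop1 D) j` are counted by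
`classCount (drop1 D) s' i j` (both halves of the XOR space at `z`). [cite: KhristoforovSmirnov2021, §1.2 (arXiv v1 pp. 2–3) and §2 Definition 3 (p. 4)] -/
theorem card_fourLoops_filter_eq_classCount {i : Fin 3} (hi : side (spFace D) i = bPred D) (j : Fin 3) :
    #((fourLoops D).filter fun ξ => (sideGraph ξ).Reachable (yc D 1) (yc (drop1 D) j)) = classCount (drop1 D) (spFace D) i j := by
  obtain ⟨hy, -⟩ := yc_one_eq_oppFace hi
  unfold classCount
  rw [← hy, ← card_filter_mem_eq hi j, ← card_filter_not_mem_eq hi j, ← Finset.card_union_of_disjoint]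
  · congr 1
    ext ξ
    simp only [Finset.mem_union, Finset.mem_filter]
    tauto
  · rw [Finset.disjoint_filter]
    intro ξ _ h1 h2
    exact h2.1 h1.1

open Classical in
/-- ★★★ **KHRISTOFOROV–SMIRNOV'S LEMMA 2 FOR A FOUR-MARKED DISCRETE DOMAIN** (`(u₁,u₂,u₃,u₄) = (y₀,y₁,y₂,y₃)`): the number of colourings
of `G` with an open crossing `A₀ ↔ A₂` equals the number of loop configurations with disorders at the four corners in which `y₁` is
linked to `y₂` (`[u₁↭u₄, u₂↭u₃]`), and the number with a closed crossing `A₁ ↔ A₃` equals the number in which `y₁` is linked to `y₀`.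
[cite: KhristoforovSmirnov2021, §1.2 Lemma 2 (arXiv v1 pp. 2–3)] -/
theorem khsLemma2_fourMarks (D : TriMarkedDomain 4) :
    #(D.verts.powerset.filter fun T : Finset (Site 2) => D.IsOpenCrossing (↑T : Set (Site 2)) 0 2) =
        #((fourLoops D).filter fun ξ => (sideGraph ξ).Reachable (yc D 1) (yc D 2)) ∧
      #(D.verts.powerset.filter fun T : Finset (Site 2) => D.IsClosedCrossing (↑T : Set (Site 2)) 1 3) =
        #((fourLoops D).filter fun ξ => (sideGraph ξ).Reachable (yc D 1) (yc D 0)) := by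
  obtain ⟨i, hi⟩ := exists_side_spFace_eq (D := D)
  obtain ⟨hu, hv, hadj⟩ := mem_triBdryDarts.1 (predDart_mem D 1)
  have hst := drop1_stretchIdx_predDart_one D
  have hv' := allSides_spFace D
  have he : side (spFace D) i = s((predDart D 1).1, (predDart D 1).2) := hi
  have h1 := classCount_one_eq_card_blueCross (D := drop1 D) hu hv hadj hst hv' he
  have h0 := classCount_zero_eq_card_yellowCross (D := drop1 D) hu hv hadj hst hv' he
  have e1 : yc (drop1 D) 1 = yc D 2 := drop1_yc D 1
  have e0 : yc (drop1 D) 0 = yc D 0 := drop1_yc D 0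
  rw [← card_fourLoops_filter_eq_classCount hi 1, e1] at h1
  rw [← card_fourLoops_filter_eq_classCount hi 0, e0] at h0
  constructor
  · rw [h1]
    exact congrArg Finset.card (Finset.filter_congr fun T _ => (blueCross_drop1_iff D T).symm)
  · rw [h0]
    exact congrArg Finset.card (Finset.filter_congr fun T _ => (yellowCross_drop1_iff D T).symm)

open Classical in
/-- ★★★ **the printed identity**: `P^perc_Ω[∂_{u₁u₂}Ω ↔ ∂_{u₃u₄}Ω] = P^loop_{Ω,{u₁,…,u₄}}[u₁↭u₄, u₂↭u₃]` — the open-crossing probability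
`P_{1/2}[A₀ ↔ A₂]` (the tree's `openCrossingProb`) is the uniform-measure probability on `W_Ω(y₀,…,y₃)` (`2 ^ #G` configurations) of the
link pattern `y₁ ↭ y₂`. [cite: KhristoforovSmirnov2021, §1.2 Lemma 2 (arXiv v1 pp. 2–3)] -/
theorem openCrossingProb_eq_loop (D : TriMarkedDomain 4) :
    D.openCrossingProb 0 2 = (#((fourLoops D).filter fun ξ => (sideGraph ξ).Reachable (yc D 1) (yc D 2)) : ℝ) / 2 ^ #D.verts ∧
      #(fourLoops D) = 2 ^ #D.verts := by
  refine ⟨?_, card_fourLoops D⟩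
  rw [← (khsLemma2_fourMarks D).1]
  unfold TriMarkedDomain.openCrossingProb TriMarkedDomain.openCrossing
  have h := triSitePercolation_half_real_setOf_eq_card_div (P := fun σ => D.IsOpenCrossing σ 0 2) D.verts (fun σ => by
    unfold TriMarkedDomain.IsOpenCrossing
    have e : (D.verts : Set (Site 2)) ∩ σ = (D.verts : Set (Site 2)) ∩ (σ ∩ (D.verts : Set (Site 2))) := by
      ext x; simp only [Set.mem_inter_iff]; tauto
    rw [← e])
  rw [h]

end Final

section NonCrossing

variable (D : TriMarkedDomain 4)

open Classical in
/-- **the two crossings partition the colourings** (Bollobás–Riordan's Lemma 5, counted): `#{A₀ ↔ A₂ open} + #{A₁ ↔ A₃ closed} = 2^{#G}`.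
[cite: BollobasRiordan2006, Ch. 7 Lemma 5 (p. 193)] -/
theorem card_open_add_card_closed :
    #(D.verts.powerset.filter fun T : Finset (Site 2) => D.IsOpenCrossing (↑T : Set (Site 2)) 0 2) +
      #(D.verts.powerset.filter fun T : Finset (Site 2) => D.IsClosedCrossing (↑T : Set (Site 2)) 1 3) = 2 ^ #D.verts := by
  have hx : ∀ T : Finset (Site 2), Xor (D.IsOpenCrossing (↑T : Set (Site 2)) 0 2) (D.IsClosedCrossing (↑T : Set (Site 2)) 1 3) :=
    fun T => tri_markedDomain_duality_holds D _
  have heq : (D.verts.powerset.filter fun T : Finset (Site 2) => D.IsClosedCrossing (↑T : Set (Site 2)) 1 3) =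
      D.verts.powerset.filter fun T : Finset (Site 2) => ¬ D.IsOpenCrossing (↑T : Set (Site 2)) 0 2 := by
    refine Finset.filter_congr fun T _ => ?_
    rcases hx T with ⟨h1, h2⟩ | ⟨h1, h2⟩
    · exact ⟨fun h => absurd h h2, fun h => absurd h1 h⟩
    · exact ⟨fun _ => h2, fun _ => h1⟩
  rw [heq, Finset.card_filter_add_card_filter_not, Finset.card_powerset]

open Classical in
/-- ★ **LINK PATTERNS ARE NON-CROSSING** (Khristoforov–Smirnov, Lemma 2: «there are two possible link patterns»): in a loop configuration
with disorders at the four corners, `y₁` is linked to `y₀` or to `y₂`, never to `y₃` — here derived from the percolation duality through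
the dictionary (counting). [cite: KhristoforovSmirnov2021, §1.2 Lemma 2 (arXiv v1 pp. 2–3)] -/
theorem card_fourLoops_linked_yc_three_eq_zero :
    #((fourLoops D).filter fun ξ => (sideGraph ξ).Reachable (yc D 1) (yc D 3)) = 0 := by
  obtain ⟨i, hi⟩ := exists_side_spFace_eq (D := D)
  -- the three classes partition W₄ (existsUnique in the XOR space, transported by the toggle) …
  have hsum := sum_classCount_eq (drop1 D) (allSides_spFace D) i
  rw [Fin.sum_univ_three, ← card_fourLoops_filter_eq_classCount hi 0, ← card_fourLoops_filter_eq_classCount hi 1,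
    ← card_fourLoops_filter_eq_classCount hi 2, drop1_yc, drop1_yc, drop1_yc] at hsum
  -- … and the first two already exhaust 2 ^ #G
  obtain ⟨h1, h0⟩ := khsLemma2_fourMarks D
  have h2 := card_open_add_card_closed D
  simp only [drop1_verts] at hsum
  have e0 : (drop1Idx 0 : Fin 4) = 0 := rfl
  have e1 : (drop1Idx 1 : Fin 4) = 2 := rfl
  have e2 : (drop1Idx 2 : Fin 4) = 3 := rfl
  rw [e0, e1, e2] at hsum
  omega

end NonCrossing

end Literature.Probability.Percolation.MarkedLoops
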